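import Literature.AlgebraicGeometry.Resolution.KollarNmPartBlowup
import Literature.AlgebraicGeometry.Resolution.KollarNmPartPullback
import Literature.AlgebraicGeometry.Resolution.StrictTransformDistinct
import HarnessLib

/-!
# Pieces of strict transforms dominate pieces below; `π^*N(I)` is divisible by no piece (Kollár 2007, 3.111 Step 3)

Topic: `Literature/AlgebraicGeometry/Resolution`. Shared infrastructure for the decomposition of
the named fact `Kollar2007Thm3_107` (`KollarBlowupSequenceFunctors.lean`; J. Kollár, *Lectures on
Resolution of Singularities*, Ann. of Math. Stud. 166 (2007), 3.111 Step 3, pp. 177–178 of the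
held copy). Step 3 of 3.111 blows up strata of the (refined) boundary of a triple `(X, I, E)` on
which `I = M(I)` up to the unit `N(I)` along `cosupp(I, m)`; to read off the multiplicities of
the transform `I_1 = F^{-m} π^*M(I) · π^*N(I)` along the irreducible components ("pieces") of the
transformed boundary `E_1 = (E^i)' ⧺ [F]` through the uniqueness of Def.–Lemma 3.110
(`divExp_eq_of_factorization`, `MonomialPart.lean`), one needs that **`π^*N(I)` is contained in
the ideal of no piece of `E_1`**. For the pieces of `F` this is the unit condition; for a piece
`W` of a strict transform `(E^i)'` it rests on a dominance statement PROVED here for the blow-up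
`π : B_Z X → X` of a triple along an admissible centre `Z = V(C)`:

* `stalkIdeal_strictTransformIdeal_eq_top_of_le_radical` — the strict transform is saturated
  with respect to the exceptional ideal, stalkwise (the local form of
  `strictTransformIdeal_eq_top_of_support_subset`); hence **no piece of a strict transform lies
  in the exceptional divisor** (`exists_mem_piece_not_mem_exceptional`);
* over the complement of the centre `π` is bijective (`exists_preimage_of_not_mem_support`,
  `eq_of_apply_eq_of_not_mem_support`, from `IsBlowup.isIso_compl`, Stacks 02OS) and the strict
  transform of `K` is supported exactly over `V(K)` (`mem_support_strictTransformIdeal_iff_of_not_mem`);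
* **`image_piece_eq`** — a piece `W` of `(E^i)'` maps ONTO the piece `P` of `E^i` containing
  `π(W)` (`π` is closed, `P ∖ V(C)` is covered by the closed images of the pieces over `P`, which
  are pairwise disjoint over `X ∖ V(C)`; irreducibility of `P`); so `pieceBelow π 𝓘_W = 𝓘_P`
  (`KollarNmPartPullback.pieceBelow`) and the piece below is unique (`exists_pieceBelow_blowup`);
* **`not_comap_nmPart_le_of_mem_splitBoundary`** — for a triple with `N(I)` a unit along the
  centre, `π^*N(I) ⊄ 𝓘_Q` for every piece `Q` of `E_1`.

## Sources

* J. Kollár, *Lectures on Resolution of Singularities* (2007), 3.111 Step 3 (pp. 177–178 of the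
  held copy), Def.–Lemma 3.110 (p. 176). [Kollar2007]
* The Stacks Project, Tag 02OS (a blowing up is an isomorphism away from the centre); U. Görtz,
  T. Wedhorn, *Algebraic Geometry I* (2020), (13.19) (strict transform as a closure).
  [StacksProject] [GortzWedhorn2020]
-/

noncomputable section

open CategoryTheory CategoryTheory.Limits AlgebraicGeometry TopologicalSpace IsLocalRing

namespace Literature.AlgebraicGeometry.Resolution

universe u

/-! ## The strict transform is saturated with respect to the exceptional ideal, stalkwise -/

/-- **Local saturation of the strict transform**: if at `x'` the exceptional ideal lies in the
radical of the stalk of the strict transform `S = ⋃ₙ (π^*K : 𝓘(F)ⁿ)`, then `S_{x'}` is the unit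
ideal (`𝓘(F)_{x'}ᴺ ⊆ S_{x'} = ⋃ₙ (K' : 𝓘(F)_{x'}ⁿ)` forces `1 ∈ (K' : 𝓘(F)^{M+N}) ⊆ S_{x'}`).
[cite: GortzWedhorn2020, (13.19) p. 414] -/
theorem stalkIdeal_strictTransformIdeal_eq_top_of_le_radical {X X' : Scheme.{u}}
    [IsLocallyNoetherian X'] (π : X' ⟶ X) (C K : X.IdealSheafData) {x' : X'}
    (hle : stalkIdeal (C.comap π) x' ≤ (stalkIdeal (strictTransformIdeal π C K) x').radical) :
    stalkIdeal (strictTransformIdeal π C K) x' = ⊤ := by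
  set S := strictTransformIdeal π C K with hSdef
  set F := C.comap π with hFdef
  haveI : IsNoetherianRing (X'.presheaf.stalk x') := inferInstance
  have hfg : (stalkIdeal F x').FG := IsNoetherian.noetherian _
  obtain ⟨N, hN⟩ := Ideal.exists_pow_le_of_le_radical_of_fg hle hfg
  have hS : stalkIdeal S x' = ⨆ n : ℕ, Submodule.colon ((stalkIdeal K (π x')).map (π.stalkMap x').hom)
      ((stalkIdeal F x' ^ n : Ideal _) : Set (X'.presheaf.stalk x')) :=
    stalkIdeal_strictTransformIdeal π C K x'
  set K' := (stalkIdeal K (π x')).map (π.stalkMap x').hom with hK'def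
  have hmono : Monotone fun n : ℕ =>
      Submodule.colon K' ((stalkIdeal F x' ^ n : Ideal _) : Set (X'.presheaf.stalk x')) := by
    intro a b hab z hz
    rw [Submodule.mem_colon] at hz ⊢
    intro p hp
    exact hz p (Ideal.pow_le_pow_right hab hp)
  have hfgN : (stalkIdeal F x' ^ N).FG := IsNoetherian.noetherian _
  rw [hS] at hN
  obtain ⟨M, hM⟩ : ∃ M : ℕ, stalkIdeal F x' ^ N ≤
      Submodule.colon K' ((stalkIdeal F x' ^ M : Ideal _) : Set (X'.presheaf.stalk x')) := by
    obtain ⟨s, hs⟩ := hfgN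
    have key : ∀ z ∈ (s : Set (X'.presheaf.stalk x')), ∃ M : ℕ,
        z ∈ Submodule.colon K' ((stalkIdeal F x' ^ M : Ideal _) : Set (X'.presheaf.stalk x')) := by
      intro z hz
      have hz' : z ∈ stalkIdeal F x' ^ N := hs ▸ Ideal.subset_span hz
      have := hN hz'
      exact (Submodule.mem_iSup_of_directed _ hmono.directed_le).mp this
    choose! Mz hMz using key
    refine ⟨s.sup Mz, ?_⟩
    rw [← hs, Ideal.span_le]
    intro z hz
    exact hmono (Finset.le_sup hz) (hMz z hz)
  rw [hS, Ideal.eq_top_iff_one]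
  refine (Submodule.mem_iSup_of_directed _ hmono.directed_le).mpr ⟨M + N, ?_⟩
  rw [Submodule.mem_colon]
  intro p hp
  rw [pow_add] at hp
  simp only [smul_eq_mul, one_mul]
  refine Submodule.mul_induction_on hp (fun a ha b hb => ?_) (fun a b ha hb => Submodule.add_mem _ ha hb)
  have hb' := hM hb
  rw [Submodule.mem_colon] at hb'
  have := hb' a ha
  simpa [smul_eq_mul, mul_comm] using this

namespace Kollar2007.Triple

variable {k : Type u} [Field k] {n : ℕ} (T : Triple k n) (C : T.X.IdealSheafData)
  {X' : Scheme.{u}} (π : X' ⟶ T.X) (hπ : IsBlowup π C)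

/-! ## No piece of a strict transform lies in the exceptional divisor -/

/-- The support of a strict transform lies over the support of the divisor. [folklore] -/
theorem subset_support_comap_of_isPiecePartition {K : T.X.IdealSheafData} {Ws : List (Closeds X')}
    (hWs : IsPiecePartition (strictTransformIdeal π C K) Ws) {W : Closeds X'} (hW : W ∈ Ws) :
    (W : Set X') ⊆ (K.comap π).support := by
  intro w hw
  have h2 := mem_support_of_mem_support_strictTransformIdeal (hWs.subset hW hw)
  rw [Scheme.IdealSheafData.support_comap]
  exact h2

include hπ in
/-- **No piece of a strict transform lies in the exceptional divisor**: at a point of such a piece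
the exceptional ideal would lie in the stalk of the strict transform — a member of the snc
boundary `(E^i)' ⧺ [F]`, whose stalk there is the stalk of the piece — which is saturated.
[cite: GortzWedhorn2020, (13.19) p. 414] -/
theorem exists_mem_piece_not_mem_exceptional (hsnc : HasSNCWith T.boundary C) {K : T.X.IdealSheafData}
    (hK : K ∈ T.boundary) {Ws : List (Closeds X')} (hWs : IsPiecePartition (strictTransformIdeal π C K) Ws)
    {W : Closeds X'} (hW : W ∈ Ws) (hWne : (W : Set X').Nonempty) :
    ∃ w ∈ (W : Set X'), w ∉ (C.comap π).support := by
  by_contra h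
  push Not at h
  haveI : IsProper π := hπ.isProper
  haveI : IsLocallyNoetherian X' := LocallyOfFiniteType.isLocallyNoetherian π
  obtain ⟨w, hw⟩ := hWne
  -- the transformed boundary is snc and contains `K'`
  have hsnc₁ : HasSNC (T.boundary.map (strictTransformIdeal π C) ++ [C.comap π]) :=
    MarkedIdeal.hasSNC_transform_boundary (T.marked 1) hsnc hπ
  have hK' : strictTransformIdeal π C K ∈ T.boundary.map (strictTransformIdeal π C) ++ [C.comap π] :=
    List.mem_append_left _ (List.mem_map.mpr ⟨K, hK, rfl⟩)
  -- `F ≤ 𝓘_W`, and `(𝓘_W)_w = K'_w`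
  have hFW : C.comap π ≤ Scheme.IdealSheafData.vanishingIdeal W :=
    Scheme.IdealSheafData.le_support_iff_le_vanishingIdeal.mp fun x hx => h x hx
  have hst : stalkIdeal (Scheme.IdealSheafData.vanishingIdeal W) w =
      stalkIdeal (strictTransformIdeal π C K) w := stalkIdeal_pieceIdeal_eq hsnc₁ hK' hWs hW hw
  have hle : stalkIdeal (C.comap π) w ≤ (stalkIdeal (strictTransformIdeal π C K) w).radical :=
    ((stalkIdeal_mono hFW w).trans hst.le).trans Ideal.le_radical
  have htop := stalkIdeal_strictTransformIdeal_eq_top_of_le_radical π C K hle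
  have hwK' : w ∈ (strictTransformIdeal π C K).support := hWs.subset hW hw
  rw [mem_support_iff_stalkIdeal_le, htop, top_le_iff] at hwK'
  exact (maximalIdeal.isMaximal _).ne_top hwK'

/-! ## Over the complement of the centre -/

include hπ in
/-- **Over the complement of the centre the blow-up is surjective.** [cite: StacksProject, Tag 02OS] -/
theorem exists_preimage_of_not_mem_support {y : T.X} (hy : y ∉ C.support) : ∃ y' : X', π y' = y := by
  haveI := hπ.isIso_compl
  set U : T.X.Opens := ⟨(C.support : Set T.X)ᶜ, C.support.isClosed.isOpen_compl⟩
  have hsurj : Function.Surjective (π ∣_ U) := (Scheme.homeoOfIso (asIso (π ∣_ U))).surjective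
  obtain ⟨a, ha⟩ := hsurj ⟨y, hy⟩
  refine ⟨a.1, ?_⟩
  have := congrArg Subtype.val ha
  rwa [morphismRestrict_base_coe] at this

include hπ in
/-- **Over the complement of the centre the blow-up is injective.** [cite: StacksProject, Tag 02OS] -/
theorem eq_of_apply_eq_of_not_mem_support {x' y' : X'} (hx : π x' ∉ C.support) (he : π x' = π y') :
    x' = y' := by
  haveI := hπ.isIso_compl
  set U : T.X.Opens := ⟨(C.support : Set T.X)ᶜ, C.support.isClosed.isOpen_compl⟩
  have hinj : Function.Injective (π ∣_ U) := (Scheme.homeoOfIso (asIso (π ∣_ U))).injective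
  have hx' : x' ∈ π ⁻¹ᵁ U := hx
  have hy' : y' ∈ π ⁻¹ᵁ U := by
    show π y' ∉ C.support
    rw [← he]; exact hx
  have key : (π ∣_ U) ⟨x', hx'⟩ = (π ∣_ U) ⟨y', hy'⟩ := by
    apply Subtype.ext
    rw [morphismRestrict_base_coe, morphismRestrict_base_coe]
    exact he
  exact congrArg Subtype.val (hinj key)

include hπ in
/-- **Off the exceptional divisor the strict transform of `K` is supported exactly over `V(K)`.**
[cite: GortzWedhorn2020, (13.19) p. 414] -/
theorem mem_support_strictTransformIdeal_iff_of_not_mem (K : T.X.IdealSheafData) {y' : X'}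
    (hy' : y' ∉ (C.comap π).support) :
    y' ∈ (strictTransformIdeal π C K).support ↔ π y' ∈ K.support := by
  refine ⟨mem_support_of_mem_support_strictTransformIdeal, fun hy => ?_⟩
  haveI : IsProper π := hπ.isProper
  haveI : IsLocallyNoetherian X' := LocallyOfFiniteType.isLocallyNoetherian π
  rw [mem_support_iff_stalkIdeal_le, stalkIdeal_strictTransformIdeal_of_not_mem π C K hy']
  rw [mem_support_iff_stalkIdeal_le] at hy
  haveI : IsLocalHom (π.stalkMap y').hom := π.toLRSHom.prop y'
  refine (Ideal.map_mono hy).trans ?_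
  rw [Ideal.map_le_iff_le_comap]
  intro a ha
  rw [Ideal.mem_comap, IsLocalRing.mem_maximalIdeal, mem_nonunits_iff]
  rw [IsLocalRing.mem_maximalIdeal, mem_nonunits_iff] at ha
  exact fun hu => ha ((isUnit_map_iff (π.stalkMap y').hom a).mp hu)

include hπ in
/-- The image of a closed subset of the blow-up is closed (blow-ups are proper). [folklore] -/
theorem isClosed_image (W : Closeds X') : IsClosed (π '' (W : Set X')) := by
  haveI : IsProper π := hπ.isProper
  exact π.isClosedMap _ W.isClosed

/-! ## Dominance: a piece of a strict transform maps onto the piece below -/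

include hπ in
/-- **A piece `W` of the strict transform `(E^i)'` maps ONTO the piece `P` of `E^i` containing its
image**: the points of `P` off the centre have preimages, lying on pieces of `(E^i)'` over `P`,
whose images are closed and cover the dense open `P ∖ V(C)` of the irreducible `P`; so `P` lies in
the image of ONE such piece, and any other piece over `P` would meet it over `X ∖ V(C)`, where `π`
is injective. (`Ws`: any partition of `V((E^i)')` into irreducible closed pieces, e.g. its
irreducible components.) [cite: Kollar2007, 3.111 Step 3 (p. 177)] -/
theorem image_piece_eq (hsnc : HasSNCWith T.boundary C) {K : T.X.IdealSheafData} (hK : K ∈ T.boundary)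
    {Ws : List (Closeds X')} (hWs : IsPiecePartition (strictTransformIdeal π C K) Ws)
    (hWirr : ∀ W ∈ Ws, IsIrreducible (W : Set X')) {W : Closeds X'} (hW : W ∈ Ws)
    {P : Closeds T.X} (hP : P ∈ boundaryPieces K) (hWP : π '' (W : Set X') ⊆ (P : Set T.X)) :
    π '' (W : Set X') = (P : Set T.X) := by
  classical
  have hPs := T.isPiecePartition_boundaryPieces_of_mem hK
  -- the pieces of `K'` over `P`
  set overP := Ws.filter fun W' : Closeds X' => decide (π '' (W' : Set X') ⊆ (P : Set T.X)) with hoverP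
  -- `P ∖ V(C)` is covered by their (closed) images
  have hcover : (P : Set T.X) ∩ (C.support : Set T.X)ᶜ ⊆ ⋃ W' ∈ overP, π '' (W' : Set X') := by
    rintro y ⟨hyP, hyC⟩
    obtain ⟨y', rfl⟩ := T.exists_preimage_of_not_mem_support C π hπ hyC
    have hy'F : y' ∉ (C.comap π).support := by
      rw [Scheme.IdealSheafData.support_comap]; exact hyC
    have hy'K' : y' ∈ (strictTransformIdeal π C K).support :=
      (T.mem_support_strictTransformIdeal_iff_of_not_mem C π hπ K hy'F).mpr (hPs.subset hP hyP)
    obtain ⟨W', hW', hy'W'⟩ := hWs.exists_mem hy'K'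
    obtain ⟨P', hP', hW'P'⟩ := exists_piece_image_subset π hPs (hWirr W' hW')
      (T.subset_support_comap_of_isPiecePartition C π hWs hW')
    have hPP' : P' = P := hPs.eq_of_mem hP' hP (hW'P' ⟨y', hy'W', rfl⟩) hyP
    subst hPP'
    exact Set.mem_biUnion (List.mem_filter.mpr ⟨hW', decide_eq_true hW'P'⟩) ⟨y', hy'W', rfl⟩
  -- `P` is irreducible and `P ∖ V(C)` is non-empty (our `W` has a point off `F`)
  have hPirr : IsIrreducible (P : Set T.X) := isIrreducible_of_mem_boundaryPieces hP
  obtain ⟨w, hwW, hwF⟩ := T.exists_mem_piece_not_mem_exceptional C π hπ hsnc hK hWs hW (hWirr W hW).nonempty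
  have hwC : π w ∉ C.support := by
    rw [Scheme.IdealSheafData.support_comap] at hwF; exact hwF
  have hPU : ((P : Set T.X) ∩ (C.support : Set T.X)ᶜ).Nonempty := ⟨π w, hWP ⟨w, hwW, rfl⟩, hwC⟩
  have hdense : (P : Set T.X) ⊆ closure ((P : Set T.X) ∩ (C.support : Set T.X)ᶜ) :=
    subset_closure_inter_of_isPreirreducible_of_isOpen hPirr.2 C.support.isClosed.isOpen_compl hPU
  have hclosed : IsClosed (⋃ W' ∈ overP, π '' (W' : Set X')) :=
    (List.finite_toSet overP).isClosed_biUnion fun W' _ => T.isClosed_image C π hπ W'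
  have hPsub : (P : Set T.X) ⊆ ⋃ W' ∈ overP, π '' (W' : Set X') :=
    hdense.trans (closure_minimal hcover hclosed)
  -- so `P` lies in ONE of these images
  obtain ⟨W₀, hW₀, hPW₀⟩ : ∃ W₀ ∈ overP, (P : Set T.X) ⊆ π '' (W₀ : Set X') := by
    have himg := (isIrreducible_iff_sUnion_isClosed.mp hPirr)
      ((overP.map fun W' : Closeds X' => π '' (W' : Set X')).toFinset)
      (fun z hz => by
        obtain ⟨W', -, rfl⟩ := List.mem_map.mp (List.mem_toFinset.mp hz)
        exact T.isClosed_image C π hπ W')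
      (fun y hy => by
        obtain ⟨W', hW', hy'⟩ := Set.mem_iUnion₂.mp (hPsub hy)
        exact Set.mem_sUnion.mpr ⟨_, Finset.mem_coe.mpr (List.mem_toFinset.mpr
          (List.mem_map.mpr ⟨W', hW', rfl⟩)), hy'⟩)
    obtain ⟨z, hz, hPz⟩ := himg
    obtain ⟨W₀, hW₀, rfl⟩ := List.mem_map.mp (List.mem_toFinset.mp hz)
    exact ⟨W₀, hW₀, hPz⟩
  obtain ⟨hW₀mem, hW₀P⟩ := List.mem_filter.mp hW₀
  -- our `W` is that piece: its point `w` off `F` has its image in `P = π(W₀)`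
  obtain ⟨w₀, hw₀, hww₀⟩ := hPW₀ (hWP ⟨w, hwW, rfl⟩)
  have hw₀eq : w₀ = w := by
    refine T.eq_of_apply_eq_of_not_mem_support C π hπ ?_ hww₀
    rw [hww₀]; exact hwC
  subst hw₀eq
  have hWW₀ : W = W₀ := hWs.eq_of_mem hW hW₀mem hwW hw₀
  subst hWW₀
  exact Set.Subset.antisymm hWP hPW₀

include hπ in
/-- Hence **the piece below** (`KollarNmPartPullback.pieceBelow`: the ideal of the closure of the
image) **of a piece `W` of `(E^i)'` is the ideal of the piece of `E^i` containing `π(W)`.**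
[cite: Kollar2007, 3.111 Step 3 (p. 177)] -/
theorem pieceBelow_eq_of_image_subset (hsnc : HasSNCWith T.boundary C) {K : T.X.IdealSheafData}
    (hK : K ∈ T.boundary) {Ws : List (Closeds X')} (hWs : IsPiecePartition (strictTransformIdeal π C K) Ws)
    (hWirr : ∀ W ∈ Ws, IsIrreducible (W : Set X')) {W : Closeds X'} (hW : W ∈ Ws)
    {P : Closeds T.X} (hP : P ∈ boundaryPieces K) (hWP : π '' (W : Set X') ⊆ (P : Set T.X)) :
    pieceBelow π (Scheme.IdealSheafData.vanishingIdeal W) = Scheme.IdealSheafData.vanishingIdeal P := by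
  rw [pieceBelow]
  congr 1
  ext1
  show closure (π '' ((Scheme.IdealSheafData.vanishingIdeal W).support : Set X')) = (P : Set T.X)
  rw [coe_support_vanishingIdeal, T.image_piece_eq C π hπ hsnc hK hWs hWirr hW hP hWP, P.isClosed.closure_eq]

include hπ in
/-- **The piece below a piece of a strict transform**: for a piece `W` of `(E^i)'` there is a piece
`P` of `E^i` with `π(W) = P` and `pieceBelow π 𝓘_W = 𝓘_P`. [cite: Kollar2007, 3.111 Step 3 (p. 177)] -/
theorem exists_pieceBelow_blowup (hsnc : HasSNCWith T.boundary C) {K : T.X.IdealSheafData}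
    (hK : K ∈ T.boundary) {Ws : List (Closeds X')} (hWs : IsPiecePartition (strictTransformIdeal π C K) Ws)
    (hWirr : ∀ W ∈ Ws, IsIrreducible (W : Set X')) {W : Closeds X'} (hW : W ∈ Ws) :
    ∃ P ∈ boundaryPieces K, π '' (W : Set X') = (P : Set T.X) ∧
      pieceBelow π (Scheme.IdealSheafData.vanishingIdeal W) = Scheme.IdealSheafData.vanishingIdeal P := by
  obtain ⟨P, hP, hWP⟩ := exists_piece_image_subset π (T.isPiecePartition_boundaryPieces_of_mem hK)
    (hWirr W hW) (T.subset_support_comap_of_isPiecePartition C π hWs hW)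
  exact ⟨P, hP, T.image_piece_eq C π hπ hsnc hK hWs hWirr hW hP hWP,
    T.pieceBelow_eq_of_image_subset C π hπ hsnc hK hWs hWirr hW hP hWP⟩

/-! ## `π^*N(I)` is divisible by no piece of the transformed boundary -/

include hπ in
/-- **`π^*N(I) ⊄ 𝓘_W` for a piece `W` of a strict transform `(E^i)'`**: otherwise `π(W) = P` (a
piece of `E^i`) lies in `cosupp N(I)`, i.e. `N(I) ⊆ 𝓘_P`, against Def.–Lemma 3.110.
[cite: Kollar2007, Def.–Lemma 3.110 (p. 176)] -/
theorem not_comap_nmPart_le_vanishingIdeal_piece (hsnc : HasSNCWith T.boundary C)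
    {K : T.X.IdealSheafData} (hK : K ∈ T.boundary) {Ws : List (Closeds X')}
    (hWs : IsPiecePartition (strictTransformIdeal π C K) Ws) (hWirr : ∀ W ∈ Ws, IsIrreducible (W : Set X'))
    {W : Closeds X'} (hW : W ∈ Ws) :
    ¬ T.nmPart.comap π ≤ Scheme.IdealSheafData.vanishingIdeal W := by
  intro hle
  obtain ⟨P, hP, himg, -⟩ := T.exists_pieceBelow_blowup C π hπ hsnc hK hWs hWirr hW
  have h1 : (W : Set X') ⊆ (T.nmPart.comap π).support := fun x hx =>
    (Scheme.IdealSheafData.le_support_iff_le_vanishingIdeal.mpr hle) hx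
  rw [Scheme.IdealSheafData.support_comap] at h1
  have h2 : (P : Set T.X) ⊆ T.nmPart.support := by
    rw [← himg]
    rintro _ ⟨w, hw, rfl⟩
    exact h1 hw
  have h3 : T.nmPart ≤ Scheme.IdealSheafData.vanishingIdeal P :=
    Scheme.IdealSheafData.le_support_iff_le_vanishingIdeal.mp (show P ≤ T.nmPart.support from h2)
  exact T.not_nmPart_le_of_mem_splitBoundary (T.mem_splitBoundary_iff.mpr ⟨K, hK, P, hP, rfl⟩) h3

/-- **`π^*N(I) ⊄ 𝓘_Q` for a piece `Q` of the exceptional divisor**, when `N(I)` is a unit along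
the centre (at a point of `Q`, over the centre, `π^*N(I)` is the unit ideal).
[cite: Kollar2007, 3.111 Steps 2–3 (p. 177)] -/
theorem not_comap_nmPart_le_vanishingIdeal_piece_exceptional
    (hunit : ∀ x ∈ (C.support : Set T.X), x ∉ T.nmPart.support) {Qs : List (Closeds X')}
    (hQs : IsPiecePartition (C.comap π) Qs) {Q : Closeds X'} (hQ : Q ∈ Qs) (hQne : (Q : Set X').Nonempty) :
    ¬ T.nmPart.comap π ≤ Scheme.IdealSheafData.vanishingIdeal Q := by
  intro hle
  obtain ⟨x', hx'⟩ := hQne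
  have hx'F : x' ∈ (C.comap π).support := hQs.subset hQ hx'
  have hxC : π x' ∈ C.support := by
    rw [Scheme.IdealSheafData.support_comap] at hx'F; exact hx'F
  have h1 : x' ∈ (T.nmPart.comap π).support :=
    (Scheme.IdealSheafData.le_support_iff_le_vanishingIdeal.mpr hle) hx'
  rw [Scheme.IdealSheafData.support_comap] at h1
  exact hunit _ hxC h1

/-- **`π^*N(I)` lies in the ideal of no piece of the transformed boundary `E_1`** of the blown-up
triple (`Kollar2007.Triple.blowupTriple`), provided `N(I)` is a unit along the centre (the
situation of Step 3 of 3.111: the centre lies in `cosupp(I, m)` and `cosupp(I, m) ∩ cosupp N(I) = ∅`).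
[cite: Kollar2007, 3.111 Steps 2–3 (p. 177) with Def.–Lemma 3.110] -/
theorem not_comap_nmPart_le_of_mem_splitBoundary_blowupTriple {m : ℕ} (hm : 1 ≤ m)
    (hC : (C.support : Set T.X) ⊆ (T.marked m).support) (hsnc : HasSNCWith T.boundary C)
    (hCreg : Scheme.IsRegular C.subscheme) (hunit : ∀ x ∈ (C.support : Set T.X), x ∉ T.nmPart.support)
    {Q : (T.blowupTriple hm C hC hsnc hCreg).X.IdealSheafData}
    (hQ : Q ∈ (T.blowupTriple hm C hC hsnc hCreg).splitBoundary) : ¬ T.nmPart.comap (blowup.π C) ≤ Q := by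
  set T₁ := T.blowupTriple hm C hC hsnc hCreg
  obtain ⟨K', hK', Z, hZ, rfl⟩ := T₁.mem_splitBoundary_iff.mp hQ
  have hZs := T₁.isPiecePartition_boundaryPieces_of_mem hK'
  have hirr : ∀ W ∈ boundaryPieces K', IsIrreducible (W : Set T₁.X) := fun W hW =>
    isIrreducible_of_mem_boundaryPieces hW
  have hne : (Z : Set T₁.X).Nonempty := componentsIn.nonempty (mem_boundaryPieces_iff.mp hZ)
  rcases List.mem_append.mp hK' with h | h
  · obtain ⟨K, hK, rfl⟩ := List.mem_map.mp h
    exact T.not_comap_nmPart_le_vanishingIdeal_piece C (blowup.π C) (blowup.isBlowup C) hsnc hK hZs hirr hZ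
  · obtain rfl : K' = C.comap (blowup.π C) := List.mem_singleton.mp h
    exact T.not_comap_nmPart_le_vanishingIdeal_piece_exceptional C (blowup.π C) hunit hZs hZ hne

end Kollar2007.Triple

end Literature.AlgebraicGeometry.Resolution

end
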